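import Mathlib
import HarnessLib
import Summits.AnomalousDissipation.AnomalousDissipation.Theses.DecimationAxis
import Literature.Analysis.FluidPDE.GalerkinFlow
import Literature.Analysis.FluidPDE.LongTimeAverageShift

/-!
# Helper lemmas for `stub_tameRestart` — companion of `STUB-IDEAS-stub_tameRestart-3.md`
(stub-ideation k=3, FAMILY 3 — probe the extremes; crux stmt-AnomalousDissipation-1583
`DecimationAxis.UniformEquilibration`, skeleton `Lines/birth.lean`).

Vocabulary §0 and `Sig.stub_tameRestart` are copied VERBATIM from `Lines/birth.lean` (see the P0 note of
the plan: the stub prover must state the registered signature over the skeleton's own defs).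
Status: H0, H1, H2′, H3, H4, H5, H6, H6⁺ (`restart_margins`), H7, `modalEnergy_nonneg` are CLOSED
(sorry-free, paste-ready); H2 (window enstrophy budget, ≈ 80 lines) and the ≈ 40-line assembly are left
`sorry` with the recipe in the docstring — they are the stub prover's cycle. `lean check`: rc 0, 2 sorries.
-/

set_option linter.dupNamespace false

noncomputable section

namespace Summit.AnomalousDissipation.AnomalousDissipation.Cruxes.UniformEquilibration.TameRestartIdeas3

open scoped BigOperators Topology Classical MeasureTheory InnerProductSpace ComplexConjugate
open Filter Set Function MeasureTheory
open Literature.Analysis.FunctionSpaces Literature.Analysis.FunctionSpaces.Torus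
open Literature.Analysis.FluidPDE
open Summit.AnomalousDissipation.AnomalousDissipation.Theses.DecimationAxis

/-- Integer frequencies (local notation). -/
local notation "ℤ³" => Fin 3 → ℤ
/-- Complex Fourier coefficient vectors (local notation). -/
local notation "ℂ³" => EuclideanSpace ℂ (Fin 3)

/-! ### §0 Vocabulary (verbatim from the skeleton) + enstrophy -/

def IsCoeffTrajectory (S : Finset ℤ³) (ν : ℝ) (g : ℤ³ → ℂ³) (c : ℝ → ↥S → ℂ³) : Prop :=
  (∀ t, c t ∈ galerkinSubspace S) ∧ ContinuousOn c (Set.Ici 0) ∧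
    ∀ T : ℝ, ∀ t ∈ Set.Icc (0 : ℝ) T,
      HasDerivWithinAt c (galerkinRHS S ν (fun k => g k) (c t)) (Set.Icc 0 T) t

def modalEnergy {S : Finset ℤ³} (a : ↥S → ℂ³) : ℝ :=
  ∑ k : ↥S, ‖a k‖ ^ 2

def resolvedDissipation {S : Finset ℤ³} (ν : ℝ) (M : ℕ) (a : ↥S → ℂ³) : ℝ :=
  ν * (4 * Real.pi ^ 2 * ∑ k : ↥S,
    if freqNormSq (k : ℤ³) ≤ (M : ℝ) ^ 2 then freqNormSq (k : ℤ³) * ‖a k‖ ^ 2 else 0)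

def h1Size {S : Finset ℤ³} (a : ↥S → ℂ³) : ℝ :=
  ∑ k : ↥S, (1 + freqNormSq (k : ℤ³)) * ‖a k‖ ^ 2

/-- (new, helper vocabulary) modal enstrophy `Σ_k |k|² ‖a_k‖²` (= `(eGradNormSq u).toReal / 4π²`). -/
def modalEnstrophy {S : Finset ℤ³} (a : ↥S → ℂ³) : ℝ :=
  ∑ k : ↥S, freqNormSq (k : ℤ³) * ‖a k‖ ^ 2

def Sig.stub_tameRestart : Prop :=
  ∀ (ν : ℝ), 0 < ν → ∀ (N : ℕ) (g : ℤ³ → ℂ³), IsConjSymm g → (∀ k, k ∉ freqBall N → g k = 0) →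
    g 0 = 0 → (∀ k : ℤ³, ∑ i, ((k i : ℤ) : ℂ) * g k i = 0) →
    ∀ (E ε : ℝ) (M : ℕ), 0 < ε → ∀ (T₁ E₁ ε₁ B₁ : ℝ), E₁ < 2 * E → ε < ε₁ →
      ∃ (T₀ R : ℝ), ∀ (K : ℕ) (S : Finset ℤ³), S = (freqBall K).erase 0 →
        (∃ c : ℝ → ↥S → ℂ³, IsCoeffTrajectory S ν g c ∧ (∀ t, 0 ≤ t → modalEnergy (c t) ≤ B₁) ∧
            ∀ T : ℝ, T₁ ≤ T →
              timeMean (fun t => modalEnergy (c t)) T ≤ E₁ ∧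
              ε₁ ≤ timeMean (fun t => resolvedDissipation ν M (c t)) T) →
        ∃ c : ℝ → ↥S → ℂ³, IsCoeffTrajectory S ν g c ∧ h1Size (c 0) ≤ R ∧
            ∀ T : ℝ, T₀ ≤ T →
              timeMean (fun t => modalEnergy (c t)) T ≤ 2 * E ∧
              ε ≤ timeMean (fun t => resolvedDissipation ν M (c t)) T

/-! ### Extremes audit (in-Lean sanity): the junk point `T = 0` of `timeMean` -/

/-- `timeMean φ 0 = 0`: so a hypothesis `ε₁ ≤ timeMean D T` for all `T ≥ T₁` with `T₁ ≤ 0`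
is unsatisfiable when `ε₁ > 0` — the case `T₁ ≤ 0` of the stub is vacuous. -/
example (φ : ℝ → ℝ) : timeMean φ 0 = 0 := by simp [timeMean]

/-! ### H0 — the truncation `(freqBall K).erase 0` is symmetric -/

theorem neg_mem_of_eq_erase {K : ℕ} {S : Finset ℤ³} (hS : S = (freqBall K).erase 0) :
    ∀ k ∈ S, -k ∈ S := by
  intro k hk
  subst hS
  rw [Finset.mem_erase] at hk ⊢
  exact ⟨neg_ne_zero.2 hk.1, neg_mem_freqBall.2 hk.2⟩

/-! ### H1 — trajectories are global ODE solutions; autonomy (shift) -/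

theorem isCoeffTrajectory_iff {S : Finset ℤ³} {ν : ℝ} {g : ℤ³ → ℂ³} {c : ℝ → ↥S → ℂ³} :
    IsCoeffTrajectory S ν g c ↔ IsGalerkinODESolution ν (fun k : ↥S => g k) (c 0) c :=
  ⟨fun h => ⟨rfl, h.1, h.2.1, h.2.2⟩, fun h => ⟨h.mem, h.continuousOn, h.hasDerivWithinAt⟩⟩

theorem IsCoeffTrajectory.comp_add {S : Finset ℤ³} {ν : ℝ} {g : ℤ³ → ℂ³} {c : ℝ → ↥S → ℂ³}
    (hc : IsCoeffTrajectory S ν g c) {s : ℝ} (hs : 0 ≤ s) :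
    IsCoeffTrajectory S ν g (fun τ => c (τ + s)) := by
  have h := (isCoeffTrajectory_iff.1 hc).comp_add hs
  exact ⟨h.mem, h.continuousOn, h.hasDerivWithinAt⟩

/-! ### H7 — continuity of the three observables along a trajectory -/

theorem continuousOn_modalEnergy {S : Finset ℤ³} {c : ℝ → ↥S → ℂ³} {A : Set ℝ}
    (hc : ContinuousOn c A) : ContinuousOn (fun t => modalEnergy (c t)) A := by
  unfold modalEnergy
  exact continuousOn_finsetSum _ fun k _ => ((continuous_apply k).comp_continuousOn hc).norm.pow 2

theorem continuousOn_modalEnstrophy {S : Finset ℤ³} {c : ℝ → ↥S → ℂ³} {A : Set ℝ}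
    (hc : ContinuousOn c A) : ContinuousOn (fun t => modalEnstrophy (c t)) A := by
  unfold modalEnstrophy
  exact continuousOn_finsetSum _ fun k _ =>
    continuousOn_const.mul (((continuous_apply k).comp_continuousOn hc).norm.pow 2)

theorem continuousOn_resolvedDissipation {S : Finset ℤ³} (ν : ℝ) (M : ℕ) {c : ℝ → ↥S → ℂ³}
    {A : Set ℝ} (hc : ContinuousOn c A) :
    ContinuousOn (fun t => resolvedDissipation ν M (c t)) A := by
  unfold resolvedDissipation
  refine continuousOn_const.mul (continuousOn_const.mul (continuousOn_finsetSum _ fun k _ => ?_))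
  split_ifs
  · exact continuousOn_const.mul (((continuous_apply k).comp_continuousOn hc).norm.pow 2)
  · exact continuousOn_const

/-! ### H2 — unit-window enstrophy budget (energy identity on `[0,1]`, AM–GM on the power; no √) -/

/-- `ν·4π² ∫₀¹ Σ|k|²‖c_k‖² ≤ B + ½ Σ_{k∈S} ‖g k‖²` for a trajectory with `Σ‖c(t)_k‖² ≤ B` on `[0,1]`:
`e' = 2(−ν·4π²·Z + P)` (`hasDerivWithinAt_energy` + `toReal_eGradNormSq_coeffExt` +
`integral_inner_realTrigPoly_realTrigPoly`), `2P ≤ Σ‖g_k‖² + e` (as in `energy_deriv_le`), FTC on `[0,1]`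
(`intervalIntegral.integral_eq_sub_of_hasDeriv_right_of_le`, template: proof of `galerkin_energy_identity`). -/
theorem enstrophy_window_budget {S : Finset ℤ³} (hS : ∀ k ∈ S, -k ∈ S) {ν : ℝ} (hν : 0 ≤ ν)
    {g : ℤ³ → ℂ³} (hg : IsConjSymm g) {c : ℝ → ↥S → ℂ³} (hc : IsCoeffTrajectory S ν g c)
    {B : ℝ} (hB : ∀ t ∈ Set.Icc (0 : ℝ) 1, modalEnergy (c t) ≤ B) :
    ν * (4 * Real.pi ^ 2) * ∫ τ in (0 : ℝ)..1, modalEnstrophy (c τ) ≤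
      B + (∑ k : ↥S, ‖g k‖ ^ 2) / 2 := by
  sorry

/-- H2′ — the force budget is `K`-uniform: `Σ_{k∈S} ‖g k‖² ≤ Σ_{k∈freqBall N} ‖g k‖²`. -/
theorem sum_norm_sq_restrict_le {N : ℕ} {g : ℤ³ → ℂ³} (hsupp : ∀ k, k ∉ freqBall N → g k = 0)
    (S : Finset ℤ³) : ∑ k : ↥S, ‖g k‖ ^ 2 ≤ ∑ k ∈ freqBall N, ‖g k‖ ^ 2 := by
  rw [Finset.sum_coe_sort S (fun k => ‖g k‖ ^ 2)]
  have hvan : ∀ x ∈ S \ (S ∩ freqBall N), ‖g x‖ ^ 2 = 0 := fun x hx => by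
    obtain ⟨hxS, hxn⟩ := Finset.mem_sdiff.1 hx
    rw [hsupp x fun hB => hxn (Finset.mem_inter.2 ⟨hxS, hB⟩)]
    simp
  rw [← Finset.sum_subset_zero_on_sdiff Finset.inter_subset_left hvan fun _ _ => rfl]
  exact Finset.sum_le_sum_of_subset_of_nonneg Finset.inter_subset_right fun _ _ _ => sq_nonneg _

/-! ### H3 — the tame instant (extremal configuration: the enstrophy minimiser on `[0,1]`) -/

/-- H3 (abstract form): a continuous function on `[0,1]` is somewhere below its integral. -/
theorem exists_le_intervalIntegral {Z : ℝ → ℝ} (hZ : ContinuousOn Z (Set.Icc 0 1)) {Q : ℝ}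
    (hQ : ∫ τ in (0 : ℝ)..1, Z τ ≤ Q) : ∃ s ∈ Set.Icc (0 : ℝ) 1, Z s ≤ Q := by
  obtain ⟨s, hs, hmin⟩ := isCompact_Icc.exists_isMinOn (nonempty_Icc.2 zero_le_one) hZ
  refine ⟨s, hs, le_trans ?_ hQ⟩
  have hZi : IntervalIntegrable Z volume 0 1 :=
    (hZ.mono (by rw [uIcc_of_le zero_le_one])).intervalIntegrable
  have h := intervalIntegral.integral_mono_on zero_le_one intervalIntegrable_const hZi
    (fun x hx => show Z s ≤ Z x from hmin hx)
  simpa using h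

/-- A continuous function does not exceed its mean everywhere: some `s ∈ [0,1]` has
`Z(c s) ≤ ∫₀¹ Z(c τ) dτ` (`isCompact_Icc.exists_isMinOn` + `intervalIntegral.integral_mono_on`;
alternative: `MeasureTheory.exists_le_setAverage` on `Icc 0 1`). -/
theorem exists_tame_instant {S : Finset ℤ³} {c : ℝ → ↥S → ℂ³} (hc : ContinuousOn c (Set.Icc 0 1))
    {Q : ℝ} (hQ : ∫ τ in (0 : ℝ)..1, modalEnstrophy (c τ) ≤ Q) :
    ∃ s ∈ Set.Icc (0 : ℝ) 1, modalEnstrophy (c s) ≤ Q :=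
  exists_le_intervalIntegral (continuousOn_modalEnstrophy hc) hQ

/-! ### H4 — datum size = energy + enstrophy -/

theorem h1Size_eq {S : Finset ℤ³} (a : ↥S → ℂ³) : h1Size a = modalEnergy a + modalEnstrophy a := by
  simp only [h1Size, modalEnergy, modalEnstrophy, add_mul, one_mul, Finset.sum_add_distrib]

/-! ### H5 — pointwise tightness of the resolved dissipation -/

theorem resolvedDissipation_le {S : Finset ℤ³} {ν : ℝ} (hν : 0 ≤ ν) (M : ℕ) (a : ↥S → ℂ³) :
    resolvedDissipation ν M a ≤ ν * (4 * Real.pi ^ 2 * (M : ℝ) ^ 2) * modalEnergy a := by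
  have hsum : (∑ k : ↥S, if freqNormSq (k : ℤ³) ≤ (M : ℝ) ^ 2 then
      freqNormSq (k : ℤ³) * ‖a k‖ ^ 2 else 0) ≤ (M : ℝ) ^ 2 * modalEnergy a := by
    unfold modalEnergy
    rw [Finset.mul_sum]
    refine Finset.sum_le_sum fun k _ => ?_
    split_ifs with h
    · exact mul_le_mul_of_nonneg_right h (sq_nonneg _)
    · positivity
  have h4 : (0 : ℝ) ≤ 4 * Real.pi ^ 2 := by positivity
  have h := mul_le_mul_of_nonneg_left (mul_le_mul_of_nonneg_left hsum h4) hν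
  unfold resolvedDissipation
  calc _ ≤ ν * (4 * Real.pi ^ 2 * ((M : ℝ) ^ 2 * modalEnergy a)) := h
    _ = _ := by ring

theorem resolvedDissipation_nonneg {S : Finset ℤ³} {ν : ℝ} (hν : 0 ≤ ν) (M : ℕ) (a : ↥S → ℂ³) :
    0 ≤ resolvedDissipation ν M a := by
  unfold resolvedDissipation
  refine mul_nonneg hν (mul_nonneg (by positivity) (Finset.sum_nonneg fun k _ => ?_))
  split_ifs
  · exact mul_nonneg (freqNormSq_nonneg _) (sq_nonneg _)
  · exact le_rfl

theorem modalEnergy_nonneg {S : Finset ℤ³} (a : ↥S → ℂ³) : 0 ≤ modalEnergy a :=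
  Finset.sum_nonneg fun _ _ => sq_nonneg _

/-! ### H6 — running means of a restart (the quantified neighbour of
`longTimeAvgSup_comp_add_right`; both are one `timeMean_comp_add_right` away) -/

/-- Upper: `timeMean (φ(·+s)) T ≤ ((T+s)/T) · timeMean φ (T+s)` for `φ ≥ 0`. -/
theorem timeMean_comp_add_right_le {φ : ℝ → ℝ} (hφ : ∀ t, 0 ≤ φ t)
    (hint : ∀ a b, 0 ≤ a → a ≤ b → IntervalIntegrable φ volume a b) {s : ℝ} (hs : 0 ≤ s)
    {T : ℝ} (hT : 0 < T) :
    timeMean (fun t => φ (t + s)) T ≤ (T + s) / T * timeMean φ (T + s) := by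
  rw [timeMean_comp_add_right hs hT (hint 0 s le_rfl hs) (hint s (T + s) hs (by linarith))]
  have hI : 0 ≤ ∫ t in (0 : ℝ)..s, φ t := intervalIntegral.integral_nonneg hs fun t _ => hφ t
  have : 0 ≤ T⁻¹ * ∫ t in (0 : ℝ)..s, φ t := mul_nonneg (inv_nonneg.2 hT.le) hI
  linarith

/-- Lower: `timeMean φ (T+s) − s·D/T ≤ timeMean (φ(·+s)) T` for `0 ≤ φ ≤ D` on `[0,s]`. -/
theorem le_timeMean_comp_add_right {φ : ℝ → ℝ} (hφ : ∀ t, 0 ≤ φ t)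
    (hint : ∀ a b, 0 ≤ a → a ≤ b → IntervalIntegrable φ volume a b) {s D : ℝ} (hs : 0 ≤ s)
    (hD : ∀ t ∈ Set.Icc 0 s, φ t ≤ D) {T : ℝ} (hT : 0 < T) :
    timeMean φ (T + s) - s * D / T ≤ timeMean (fun t => φ (t + s)) T := by
  rw [timeMean_comp_add_right hs hT (hint 0 s le_rfl hs) (hint s (T + s) hs (by linarith))]
  have hI : ∫ t in (0 : ℝ)..s, φ t ≤ s * D := by
    have h := intervalIntegral.integral_mono_on hs (hint 0 s le_rfl hs) intervalIntegrable_const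
      (fun t ht => hD t ht)
    simpa using h
  have hTs : 0 < T + s := by linarith
  have hmean : 0 ≤ timeMean φ (T + s) := by
    unfold timeMean
    exact mul_nonneg (inv_nonneg.2 hTs.le)
      (intervalIntegral.integral_nonneg hTs.le fun t _ => hφ t)
  have h1 : timeMean φ (T + s) ≤ (T + s) / T * timeMean φ (T + s) := by
    have : 1 ≤ (T + s) / T := by rw [le_div_iff₀ hT]; linarith
    nlinarith
  have h2 : T⁻¹ * ∫ t in (0 : ℝ)..s, φ t ≤ s * D / T := by
    rw [div_eq_inv_mul]
    exact mul_le_mul_of_nonneg_left hI (inv_nonneg.2 hT.le)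
  linarith

/-! ### H6⁺ — optional packaging of the whole ε/δ arithmetic as ONE real-variable lemma -/

/-- The margins pay for the restart: with `T₀ := max T₁ 1 + |E₁|/(2E − E₁) + D/(ε₁ − ε)`. -/
theorem restart_margins {φ ψ : ℝ → ℝ} (hφ : ∀ t, 0 ≤ φ t) (hψ : ∀ t, 0 ≤ ψ t)
    (hφi : ∀ a b, 0 ≤ a → a ≤ b → IntervalIntegrable φ volume a b)
    (hψi : ∀ a b, 0 ≤ a → a ≤ b → IntervalIntegrable ψ volume a b)
    {E E₁ ε ε₁ T₁ D s : ℝ} (hE : E₁ < 2 * E) (hε : ε < ε₁) (hD0 : 0 ≤ D)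
    (hs : s ∈ Set.Icc (0 : ℝ) 1) (hDψ : ∀ t ∈ Set.Icc 0 s, ψ t ≤ D)
    (hset : ∀ T, T₁ ≤ T → timeMean φ T ≤ E₁ ∧ ε₁ ≤ timeMean ψ T) {T : ℝ}
    (hT : max T₁ 1 + |E₁| / (2 * E - E₁) + D / (ε₁ - ε) ≤ T) :
    timeMean (fun t => φ (t + s)) T ≤ 2 * E ∧ ε ≤ timeMean (fun t => ψ (t + s)) T := by
  have hgap : 0 < 2 * E - E₁ := by linarith
  have hgap' : 0 < ε₁ - ε := by linarith
  have hA : 0 ≤ |E₁| / (2 * E - E₁) := div_nonneg (abs_nonneg _) hgap.le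
  have hB : 0 ≤ D / (ε₁ - ε) := div_nonneg hD0 hgap'.le
  have hT1 : 1 ≤ T := by linarith [le_max_right T₁ 1]
  have hT0 : 0 < T := by linarith
  have hTT₁ : T₁ ≤ T + s := by linarith [le_max_left T₁ 1, hs.1]
  obtain ⟨hEm, hεm⟩ := hset (T + s) hTT₁
  constructor
  · -- energy side
    have h1 := timeMean_comp_add_right_le hφ hφi hs.1 hT0
    have hratio : 0 ≤ (T + s) / T := div_nonneg (by linarith [hs.1]) hT0.le
    have h2 : (T + s) / T * timeMean φ (T + s) ≤ (T + s) / T * E₁ :=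
      mul_le_mul_of_nonneg_left hEm hratio
    -- `(T+s)/T * E₁ = E₁ + (s/T) E₁ ≤ E₁ + |E₁|/T ≤ 2E`
    have h3 : (T + s) / T * E₁ ≤ E₁ + |E₁| / T := by
      have hsT : (T + s) / T * E₁ = E₁ + s / T * E₁ := by
        field_simp
      rw [hsT]
      have : s / T * E₁ ≤ |E₁| / T := by
        rw [div_mul_eq_mul_div, div_le_div_iff_of_pos_right hT0]
        calc s * E₁ ≤ s * |E₁| := mul_le_mul_of_nonneg_left (le_abs_self _) hs.1
          _ ≤ 1 * |E₁| := mul_le_mul_of_nonneg_right hs.2 (abs_nonneg _)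
          _ = |E₁| := one_mul _
      linarith
    have h4 : |E₁| / T ≤ 2 * E - E₁ := by
      rw [div_le_iff₀ hT0]
      have hT' : |E₁| / (2 * E - E₁) ≤ T := by linarith [le_max_right T₁ 1]
      have := (div_le_iff₀ hgap).1 hT'
      linarith [this]
    linarith
  · -- dissipation side
    have h1 := le_timeMean_comp_add_right hψ hψi hs.1 hDψ hT0
    have h2 : s * D / T ≤ D / T := by
      apply div_le_div_of_nonneg_right _ hT0.le
      nlinarith [hs.1, hs.2]
    have h3 : D / T ≤ ε₁ - ε := by
      rw [div_le_iff₀ hT0]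
      have hT' : D / (ε₁ - ε) ≤ T := by linarith [le_max_right T₁ 1]
      have := (div_le_iff₀ hgap').1 hT'
      linarith [this]
    linarith

/-! ### Assembly target (the registered stub, by the helpers) -/

/-- ASSEMBLY RECIPE (≈ 40 lines, for the stub prover; in the Theorems file the LAST theorem must be
literally `theorem stub_tameRestart : Sig.stub_tameRestart`):
```
  intro ν hν N g hcs hsupp _ _ E ε M hε T₁ E₁ ε₁ B₁ hE hεε
  set G2 : ℝ := ∑ k ∈ freqBall N, ‖g k‖ ^ 2
  set D  : ℝ := ν * (4 * Real.pi ^ 2 * (M : ℝ) ^ 2) * |B₁|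
  refine ⟨max T₁ 1 + |E₁| / (2 * E - E₁) + D / (ε₁ - ε),
          B₁ + (B₁ + G2 / 2) / (ν * (4 * Real.pi ^ 2)), ?_⟩
  rintro K S hS ⟨c, hc, hball, hset⟩
  have hS' := neg_mem_of_eq_erase hS                                   -- H0
  have hB₁ : 0 ≤ B₁ := (modalEnergy_nonneg _).trans (hball 0 le_rfl)   -- so |B₁| = B₁
  -- budget: H2 with B := B₁ on [0,1] (hball), H2′, divide by ν·4π² > 0 (`div_le_iff₀`/`le_div_iff₀`)
  have hQ : ∫ τ in (0:ℝ)..1, modalEnstrophy (c τ) ≤ (B₁ + G2 / 2) / (ν * (4 * Real.pi ^ 2)) := …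
  obtain ⟨s, hs, hZs⟩ := exists_tame_instant (hc.2.1.mono Set.Icc_subset_Ici_self) hQ   -- H3
  refine ⟨fun τ => c (τ + s), hc.comp_add hs.1, ?_, ?_⟩                 -- H1
  · -- datum: `zero_add`, H4 `h1Size_eq`, `hball s hs.1`, `hZs`, `add_le_add`
  · intro T hT
    exact restart_margins (φ := fun t => modalEnergy (c t))             -- H6⁺
      (ψ := fun t => resolvedDissipation ν M (c t)) (fun t => modalEnergy_nonneg _)
      (fun t => resolvedDissipation_nonneg hν.le M _) hφi hψi hE hεε hD0 hs hDψ hset hT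
    -- where hφi/hψi : interval integrability on [a,b] ⊆ Ici 0 from H7 + `ContinuousOn.intervalIntegrable`
    --   (`(continuousOn_modalEnergy hc.2.1).mono` with `uIcc_of_le hab ▸ Icc_subset_Ici_iff.2 ha`),
    --   hD0 : 0 ≤ D (`abs_nonneg`, `hν.le`, `positivity`),
    --   hDψ : ψ t ≤ D on Icc 0 s from H5 `resolvedDissipation_le` + `hball t ht.1` + `abs_of_nonneg hB₁`.
``` -/
theorem stub_tameRestart_plan : Sig.stub_tameRestart := by
  intro ν hν N g hcs hsupp _h0 _hdiv E ε M _hε T₁ E₁ ε₁ B₁ hE hεε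
  set G2 : ℝ := ∑ k ∈ freqBall N, ‖g k‖ ^ 2 with hG2
  set D : ℝ := ν * (4 * Real.pi ^ 2 * (M : ℝ) ^ 2) * |B₁| with hD
  refine ⟨max T₁ 1 + |E₁| / (2 * E - E₁) + D / (ε₁ - ε),
    B₁ + (B₁ + G2 / 2) / (ν * (4 * Real.pi ^ 2)), ?_⟩
  rintro K S hS ⟨c, hc, hball, hset⟩
  have hS' : ∀ k ∈ S, -k ∈ S := neg_mem_of_eq_erase hS
  have hB₁ : 0 ≤ B₁ := (modalEnergy_nonneg _).trans (hball 0 le_rfl)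
  have hν4 : 0 < ν * (4 * Real.pi ^ 2) := by positivity
  -- (1) ABSORB: unit-window enstrophy budget, `K`-uniform
  have hbudget := enstrophy_window_budget hS' hν.le hcs hc (B := B₁) (fun t ht => hball t ht.1)
  have hG : ∑ k : ↥S, ‖g k‖ ^ 2 ≤ G2 := sum_norm_sq_restrict_le hsupp S
  have hQ : ∫ τ in (0 : ℝ)..1, modalEnstrophy (c τ) ≤ (B₁ + G2 / 2) / (ν * (4 * Real.pi ^ 2)) := by
    rw [le_div_iff₀ hν4]
    calc (∫ τ in (0 : ℝ)..1, modalEnstrophy (c τ)) * (ν * (4 * Real.pi ^ 2))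
          = ν * (4 * Real.pi ^ 2) * ∫ τ in (0 : ℝ)..1, modalEnstrophy (c τ) := by ring
      _ ≤ B₁ + (∑ k : ↥S, ‖g k‖ ^ 2) / 2 := hbudget
      _ ≤ B₁ + G2 / 2 := by linarith
  -- (2) SELECT: the enstrophy minimiser on `[0,1]` is a tame instant
  obtain ⟨s, hs, hZs⟩ := exists_tame_instant (hc.2.1.mono Set.Icc_subset_Ici_self) hQ
  -- (3) SHIFT: restart there; the margins pay for the lost prefix
  refine ⟨fun τ => c (τ + s), hc.comp_add hs.1, ?_, ?_⟩
  · show h1Size (c (0 + s)) ≤ _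
    rw [zero_add, h1Size_eq]
    exact add_le_add (hball s hs.1) hZs
  · intro T hT
    have hcont : ContinuousOn c (Set.Ici 0) := hc.2.1
    have hsub : ∀ a b : ℝ, 0 ≤ a → a ≤ b → Set.uIcc a b ⊆ Set.Ici 0 := fun a b ha hab => by
      rw [Set.uIcc_of_le hab]
      exact fun t ht => ha.trans ht.1
    have hφi : ∀ a b, 0 ≤ a → a ≤ b →
        IntervalIntegrable (fun t => modalEnergy (c t)) volume a b := fun a b ha hab =>
      ((continuousOn_modalEnergy hcont).mono (hsub a b ha hab)).intervalIntegrable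
    have hψi : ∀ a b, 0 ≤ a → a ≤ b →
        IntervalIntegrable (fun t => resolvedDissipation ν M (c t)) volume a b := fun a b ha hab =>
      ((continuousOn_resolvedDissipation ν M hcont).mono (hsub a b ha hab)).intervalIntegrable
    have hD0 : 0 ≤ D := by rw [hD]; positivity
    have hDψ : ∀ t ∈ Set.Icc 0 s, resolvedDissipation ν M (c t) ≤ D := by
      intro t ht
      refine (resolvedDissipation_le hν.le M (c t)).trans ?_
      rw [hD, abs_of_nonneg hB₁]
      exact mul_le_mul_of_nonneg_left (hball t ht.1) (by positivity)
    exact restart_margins (fun t => modalEnergy_nonneg _)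
      (fun t => resolvedDissipation_nonneg hν.le M _) hφi hψi hE hεε hD0 hs hDψ hset hT

end Summit.AnomalousDissipation.AnomalousDissipation.Cruxes.UniformEquilibration.TameRestartIdeas3

end
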